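import Mathlib.Data.Finsupp.Weight
import Mathlib.Algebra.BigOperators.Finsupp.Basic
import Literature.NumberTheory.Transcendental.KZCalculusProofs
import Literature.NumberTheory.Transcendental.KZCubicalCalculus
import Literature.NumberTheory.Transcendental.KZGroundingRelations
import Literature.NumberTheory.Transcendental.KZLogCalculusProofs
import Literature.NumberTheory.Transcendental.KZSubcalculusInvariants

/-!
# `StokesGeneration` (stmt-KontsevichZagierPeriods-3586), line `Sketch`: stub `stub_mergeCubes`

Support file for the registered stub `stub_mergeCubes` (merge) of the crux `StokesGeneration`
(route UnfoldedStokes, line `Sketch` = card cube-type-a-generation). Statement: a SIGNED finite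
family `∑ᵢ εᵢ [tᵢ]` (`εᵢ ∈ ℤ`) of *germ cube representations* — closed-cube representations
`tᵢ = [[0,1]^{nᵢ}, fᵢ]` of the Kontsevich–Zagier calculus whose integrand agrees on the closed cube
with a function `hᵢ` that is `ℚ`-semialgebraic on an open neighbourhood `Vᵢ` of the cube and is
there the sum of a real power series `Σₐ cᵢ(a) xᵃ` with `Σₐ |cᵢ(a)| Rᵢ^{|a|} < ∞` for some
`Rᵢ > 1` — is congruent modulo the moves (`KZ.relations`) to ONE germ cube representation `t'` in
a common dimension `N`.

## Proof

* `N ≥ nᵢ` for all `i`; `prᵢ x = (x₀, …, x_{nᵢ-1})` the projection to the first `nᵢ` coordinates.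
* (lift) `[tᵢ] ≡ [[0,1]ᴺ, fᵢ ∘ prᵢ]` by `N − nᵢ` slabs (`KZ.IntegralRep.slab`: rule (3) with the
  primitive `t · f`, `KZ.IntegralRep.of_slab_sub_of_mem_newtonLeibnizRel`);
* (signs) `ε • [σ, f] ≡ [σ, ε f]` for `ε ∈ ℤ` (iterated integrand additivity, rule (1b):
  `KZ.IntegralRep.of_constMul_nat_sub_nsmul_mem_relations`, and `[σ, f] + [σ, −f] ≡ 0`);
* (sum) `∑ᵢ [σ, gᵢ] ≡ [σ, ∑ᵢ gᵢ]` (`KZ.of_sub_sum_integrand_mem_relations`).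
* Germ data of `t' = [[0,1]ᴺ, ∑ᵢ εᵢ fᵢ ∘ prᵢ]`: `h' = ∑ᵢ εᵢ hᵢ ∘ prᵢ` on `V' = ⋂ᵢ prᵢ⁻¹ Vᵢ` (open,
  `ℚ`-semialgebraic since each `Vᵢ` is — it carries a semialgebraic function —, and `hᵢ ∘ prᵢ` is
  semialgebraic as a coordinate preimage of a graph); coefficients
  `c'(b) = ∑ᵢ εᵢ cᵢ(a)` for `b = a` extended by zero along `Fin nᵢ ↪ Fin N` (`Finsupp.embDomain`,
  `Function.extend`), `0` off the range; radius `R' = minᵢ Rᵢ` (`2` if the family is empty):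
  `|c'(b)| R'^{|b|} ≤ ∑ᵢ |εᵢ| |cᵢ| Rᵢ^{|b|}` is summable, and `Σ_b c'(b) x^b = h'(x)` on the cube by
  transport of `HasSum` along the injection `a ↦ b` (`Function.Injective.hasSum_iff`; the
  monomial `x^b` is `(prᵢ x)^a` and `|b| = |a|`).

References: M. Kontsevich, D. Zagier, *Periods* (2001), §1.2 rules (1), (3); J. Ayoub, *Periods
and the conjectures of Grothendieck and Kontsevich–Zagier*, EMS Newsl. 91 (2014), §2.2.
-/

noncomputable section

-- `Summit.KontsevichZagierPeriods.KontsevichZagierPeriods.…` is the tree's mandated layout (single-conjunct summit).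
set_option linter.dupNamespace false

namespace Summit.KontsevichZagierPeriods.KontsevichZagierPeriods.StokesGenerationLine

open MeasureTheory Set
open Literature.NumberTheory.Transcendental
open Literature.NumberTheory.Transcendental.KZ

/-! ## Semialgebraic functions along coordinate maps -/

/-- If `f` is `ℚ`-semialgebraic on `s ⊆ ℝⁿ` and `θ : Fin n → Fin N` is any map of coordinates,
then `w ↦ f (w ∘ θ)` is `ℚ`-semialgebraic on `{w | w ∘ θ ∈ s} ⊆ ℝᴺ`: its graph is the preimage of
the graph of `f` under a coordinate map (no Tarski–Seidenberg needed). [folklore] -/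
private theorem isSemialgebraicFunOn_comp_coord {n N : ℕ} (θ : Fin n → Fin N)
    {s : Set (Fin n → ℝ)} {f : (Fin n → ℝ) → ℝ} (hf : IsSemialgebraicFunOn ℚ s f) :
    IsSemialgebraicFunOn ℚ {w : Fin N → ℝ | (fun i => w (θ i)) ∈ s}
      (fun w => f (fun i => w (θ i))) := by
  rw [isSemialgebraicFunOn_iff] at hf ⊢
  let ρ : Fin (n + 1) → Fin (N + 1) := Fin.lastCases (Fin.last N) fun i => Fin.castSucc (θ i)
  have hΓ := hf.preimage_comp ρ
  convert hΓ using 1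
  have hinit : ∀ w : Fin (N + 1) → ℝ, Fin.init (w ∘ ρ) = fun i => Fin.init w (θ i) := by
    intro w; ext i; simp [Fin.init, ρ]
  have hlast : ∀ w : Fin (N + 1) → ℝ, (w ∘ ρ) (Fin.last n) = w (Fin.last N) := by
    intro w; simp [ρ]
  ext w
  simp only [mem_setOf_eq, mem_preimage, hinit, hlast]

/-! ## Monomials and power series along a coordinate embedding -/

/-- The monomial `x ^ b` for `b` the extension by zero of `a : Fin n →₀ ℕ` along
`Fin n ↪ Fin N` is the monomial `(pr x) ^ a` of the projected point. [folklore] -/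
private theorem prod_pow_embDomain {n N : ℕ} (hle : n ≤ N) (x : Fin N → ℝ) (a : Fin n →₀ ℕ) :
    ∏ j, x j ^ (Finsupp.embDomain (Fin.castLEEmb hle) a) j = ∏ j, x (Fin.castLE hle j) ^ a j := by
  have h1 : ∏ j, x j ^ (Finsupp.embDomain (Fin.castLEEmb hle) a) j =
      (Finsupp.embDomain (Fin.castLEEmb hle) a).prod (fun j e => x j ^ e) :=
    (Finsupp.prod_fintype _ _ fun j => pow_zero _).symm
  rw [h1, Finsupp.prod_embDomain, Finsupp.prod_fintype _ _ fun j => pow_zero _]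
  simp only [Fin.castLEEmb_apply]

/-- Extension by zero along `Fin n ↪ Fin N` preserves the degree of an exponent. [folklore] -/
private theorem degree_embDomain {n N : ℕ} (hle : n ≤ N) (a : Fin n →₀ ℕ) :
    (Finsupp.embDomain (Fin.castLEEmb hle) a).degree = a.degree := by
  rw [Finsupp.embDomain_eq_mapDomain, Finsupp.degree_mapDomain]

/-- **Transport of a power series along a coordinate embedding.** If `Σₐ c(a) (pr x)^a = s`, then
the series in `N` variables with coefficients `c` extended by zero along
`a ↦ Finsupp.embDomain (Fin.castLEEmb hle) a` sums to `s` at `x`. [folklore] -/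
private theorem hasSum_extend_embDomain {n N : ℕ} (hle : n ≤ N) (c : (Fin n →₀ ℕ) → ℝ)
    (x : Fin N → ℝ) {s : ℝ}
    (h : HasSum (fun a : Fin n →₀ ℕ => c a * ∏ j, x (Fin.castLE hle j) ^ a j) s) :
    HasSum (fun b : Fin N →₀ ℕ =>
      Function.extend (Finsupp.embDomain (M := ℕ) (Fin.castLEEmb hle)) c 0 b * ∏ j, x j ^ b j)
      s := by
  have hinj := Finsupp.embDomain_injective (M := ℕ) (Fin.castLEEmb hle)
  refine (hinj.hasSum_iff (f := fun b : Fin N →₀ ℕ =>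
      Function.extend (Finsupp.embDomain (M := ℕ) (Fin.castLEEmb hle)) c 0 b * ∏ j, x j ^ b j)
    fun b hb => ?_).mp ?_
  · rw [Function.extend_apply' _ _ _ hb, Pi.zero_apply, zero_mul]
  · have : ((fun b : Fin N →₀ ℕ =>
        Function.extend (Finsupp.embDomain (M := ℕ) (Fin.castLEEmb hle)) c 0 b * ∏ j, x j ^ b j) ∘
          Finsupp.embDomain (Fin.castLEEmb hle)) =
        fun a : Fin n →₀ ℕ => c a * ∏ j, x (Fin.castLE hle j) ^ a j := by
      funext a
      simp only [Function.comp_apply, hinj.extend_apply, prod_pow_embDomain]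
    rw [this]
    exact h

/-- **Transport of absolute convergence along a coordinate embedding.** If `Σₐ |c(a)| R^{|a|}`
converges, so does the same series for `c` extended by zero along
`a ↦ Finsupp.embDomain (Fin.castLEEmb hle) a` (degrees are preserved). [folklore] -/
private theorem summable_extend_embDomain {n N : ℕ} (hle : n ≤ N) (c : (Fin n →₀ ℕ) → ℝ)
    (R : ℝ) (h : Summable (fun a : Fin n →₀ ℕ => |c a| * R ^ a.degree)) :
    Summable (fun b : Fin N →₀ ℕ =>
      |Function.extend (Finsupp.embDomain (M := ℕ) (Fin.castLEEmb hle)) c 0 b| * R ^ b.degree) := by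
  have hinj := Finsupp.embDomain_injective (M := ℕ) (Fin.castLEEmb hle)
  refine (hinj.summable_iff (f := fun b : Fin N →₀ ℕ =>
      |Function.extend (Finsupp.embDomain (M := ℕ) (Fin.castLEEmb hle)) c 0 b| * R ^ b.degree)
    fun b hb => ?_).mp ?_
  · rw [Function.extend_apply' _ _ _ hb, Pi.zero_apply, abs_zero, zero_mul]
  · have : ((fun b : Fin N →₀ ℕ =>
        |Function.extend (Finsupp.embDomain (M := ℕ) (Fin.castLEEmb hle)) c 0 b| * R ^ b.degree) ∘
          Finsupp.embDomain (Fin.castLEEmb hle)) =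
        fun a : Fin n →₀ ℕ => |c a| * R ^ a.degree := by
      funext a
      simp only [Function.comp_apply, hinj.extend_apply, degree_embDomain]
    rw [this]
    exact h

/-! ## Moves: lifting to a higher cube, integer multiples, finite sums -/

/-- Rewriting the domain of a representation along a set equality (the representation with the
rewritten domain is the same structure). [folklore] -/
private theorem exists_domain_eq' {N : ℕ} (r : IntegralRep N) {s : Set (Fin N → ℝ)}
    (hs : r.domain = s) :
    ∃ r' : IntegralRep N, r'.domain = s ∧ r'.integrand = r.integrand ∧
      of r - of r' ∈ relations := by
  subst hs
  exact ⟨r, rfl, rfl, by simp [relations.zero_mem]⟩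

/-- **Lifting a cube representation by one slab**: `[□ᴺ, f] ∼ [□ᴺ⁺¹, f ∘ init]` (one Newton–Leibniz
move with primitive `t · f`, `KZ.IntegralRep.slab`). [cite: KontsevichZagier2001, §1.2 rule (3)] -/
private theorem liftCube_succ' (N : ℕ) (t : IntegralRep N)
    (ht : t.domain = Set.pi Set.univ (fun _ : Fin N => Set.Icc (0:ℝ) 1)) :
    ∃ t' : IntegralRep (N + 1),
      t'.domain = Set.pi Set.univ (fun _ : Fin (N + 1) => Set.Icc (0:ℝ) 1) ∧
      (∀ x ∈ Set.pi Set.univ (fun _ : Fin (N + 1) => Set.Icc (0:ℝ) 1),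
        t'.integrand x = t.integrand (Fin.init x)) ∧
      of t - of t' ∈ relations := by
  have hdom : (t.slab 0).domain = Set.pi Set.univ (fun _ : Fin (N + 1) => Set.Icc (0:ℝ) 1) := by
    ext z
    simp only [IntegralRep.domain_slab, IntegralRep.slabDomain, ht, Nat.cast_zero, zero_add,
      mem_setOf_eq, mem_pi, mem_univ, true_implies, mem_Icc]
    constructor
    · rintro ⟨h1, h2, h3⟩ i
      refine Fin.lastCases ?_ (fun j => ?_) i
      · exact ⟨h2, h3⟩
      · simpa [Fin.init] using h1 j
    · intro hz
      exact ⟨fun j => by simpa [Fin.init] using hz (Fin.castSucc j), (hz (Fin.last N)).1,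
        (hz (Fin.last N)).2⟩
  obtain ⟨t', ht'd, ht'i, hrel⟩ := exists_domain_eq' (t.slab 0) hdom
  refine ⟨t', ht'd, fun x _ => by rw [ht'i]; rfl, ?_⟩
  have h1 : of (t.slab 0) - of t ∈ relations :=
    newtonLeibnizRel_subset_relations (t.of_slab_sub_of_mem_newtonLeibnizRel 0)
  have : of t - of t' = -(of (t.slab 0) - of t) + (of (t.slab 0) - of t') := by abel
  rw [this]
  exact relations.add_mem (relations.neg_mem h1) hrel

/-- **Lifting a cube representation to any higher dimension**: `[□ᴺ, f] ∼ [□ᴹ, f ∘ pr]` for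
`N ≤ M`, `pr` the projection to the first `N` coordinates (iterate `liftCube_succ'`).
[cite: KontsevichZagier2001, §1.2 rule (3)] -/
private theorem liftCube' (N M : ℕ) (hNM : N ≤ M) (t : IntegralRep N)
    (ht : t.domain = Set.pi Set.univ (fun _ : Fin N => Set.Icc (0:ℝ) 1)) :
    ∃ t' : IntegralRep M, t'.domain = Set.pi Set.univ (fun _ : Fin M => Set.Icc (0:ℝ) 1) ∧
      (∀ x ∈ Set.pi Set.univ (fun _ : Fin M => Set.Icc (0:ℝ) 1),
        t'.integrand x = t.integrand (fun l => x (Fin.castLE hNM l))) ∧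
      of t - of t' ∈ relations := by
  obtain ⟨d, rfl⟩ := Nat.exists_eq_add_of_le hNM
  induction d with
  | zero =>
    refine ⟨t, ht, fun x _ => ?_, by simp [relations.zero_mem]⟩
    rfl
  | succ d ih =>
    obtain ⟨t₁, ht₁d, ht₁i, ht₁r⟩ := ih (Nat.le_add_right N d)
    obtain ⟨t₂, ht₂d, ht₂i, ht₂r⟩ := liftCube_succ' (N + d) t₁ ht₁d
    refine ⟨t₂, ht₂d, fun x hx => ?_, ?_⟩
    · rw [ht₂i x hx, ht₁i (Fin.init x) (fun j _ => hx (Fin.castSucc j) (mem_univ _))]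
      rfl
    · have : of t - of t₂ = (of t - of t₁) + (of t₁ - of t₂) := by abel
      rw [this]
      exact relations.add_mem ht₁r ht₂r

/-- **Integer multiples are integrand scalings**: for `ε ∈ ℤ`, `ε • [σ, f] ≡ [σ, ε f]` modulo the
moves (for `ε = k ≥ 0` this is `[σ, k f] ≡ k • [σ, f]`, iterated integrand additivity; for
`ε = −k`, moreover `[σ, k f] + [σ, −k f] ≡ 0`). [cite: KontsevichZagier2001, §1.2 rule (1)] -/
private theorem exists_zsmulRep {N : ℕ} (T : IntegralRep N) (ε : ℤ) :
    ∃ T' : IntegralRep N, T'.domain = T.domain ∧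
      (T'.integrand = fun x => (ε : ℝ) * T.integrand x) ∧ ε • of T - of T' ∈ relations := by
  refine ⟨T.constMul (ε : ℝ) (isAlgebraic_int ε), rfl, rfl, ?_⟩
  obtain ⟨k, rfl | rfl⟩ := Int.eq_nat_or_neg ε
  · have h1 := T.of_constMul_nat_sub_nsmul_mem_relations k
    have h2 : of (T.constMul ((k : ℤ) : ℝ) (isAlgebraic_int k)) -
        of (T.constMul (k : ℝ) (isAlgebraic_nat k)) ∈ relations :=
      of_sub_of_mem_relations_of_eqOn rfl fun x _ => by simp
    convert relations.neg_mem (relations.add_mem h1 h2) using 1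
    rw [natCast_zsmul]
    abel
  · have h1 := T.of_constMul_nat_sub_nsmul_mem_relations k
    have h3 : of (T.constMul (k : ℝ) (isAlgebraic_nat k)) +
        of (T.constMul ((-(k : ℤ) : ℤ) : ℝ) (isAlgebraic_int (-(k : ℤ)))) ∈ relations :=
      of_add_of_mem_relations_of_eqOn_neg rfl fun x _ => by simp
    convert relations.sub_mem h1 h3 using 1
    rw [neg_zsmul, natCast_zsmul]
    abel

/-- **Finite sums are one integrand** (iterated integrand additivity, rule (1b)):
`∑ᵢ [σ, gᵢ] ≡ [σ, ∑ᵢ gᵢ]`. [cite: KontsevichZagier2001, §1.2 rule (1)] -/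
private theorem exists_sumRep {N S : ℕ} (σ : Set (Fin N → ℝ))
    (hσ : Literature.ModelTheory.ExponentialFields.IsSemialgebraic ℚ σ)
    (T : Fin S → IntegralRep N) (hT : ∀ i, (T i).domain = σ) :
    ∃ T' : IntegralRep N, T'.domain = σ ∧ (T'.integrand = fun x => ∑ i, (T i).integrand x) ∧
      ∑ i, of (T i) - of T' ∈ relations := by
  let T' : IntegralRep N :=
    { domain := σ
      integrand := fun x => ∑ i, (T i).integrand x
      isSemialgebraic_domain := hσ
      isSemialgebraicFunOn_integrand :=
        isSemialgebraicFunOn_finset_sum Finset.univ hσ fun i _ =>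
          hT i ▸ (T i).isSemialgebraicFunOn_integrand
      integrableOn := integrable_finsetSum Finset.univ fun i _ => hT i ▸ (T i).integrableOn }
  refine ⟨T', rfl, rfl, ?_⟩
  have h := of_sub_sum_integrand_mem_relations Finset.univ T T' (fun i _ => hT i) fun x _ => rfl
  convert relations.neg_mem h using 1
  abel

/-! ## The stub -/

/-- STUB (merge) a signed finite family of germ cube representations is KZ-equivalent to ONE germ
cube representation in a common dimension (raise every member to the top dimension by slabs —
rule 3 with primitive `t · f`, `KZ.IntegralRep.slab` —, absorb the signs `εᵢ` into the integrands
and add them by integrand additivity, rule 1b). [cite: KontsevichZagier2001, §1.2] -/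
theorem stub_mergeCubes :
    ∀ (S : ℕ) (n : Fin S → ℕ) (ε : Fin S → ℤ) (h : (i : Fin S) → (Fin (n i) → ℝ) → ℝ)
      (V : (i : Fin S) → Set (Fin (n i) → ℝ)) (c : (i : Fin S) → (Fin (n i) →₀ ℕ) → ℝ)
      (R : Fin S → ℝ) (t : (i : Fin S) → IntegralRep (n i)),
      (∀ i, IsOpen (V i) ∧ Set.pi Set.univ (fun _ : Fin (n i) => Set.Icc (0:ℝ) 1) ⊆ V i ∧
        IsSemialgebraicFunOn ℚ (V i) (h i) ∧ 1 < R i ∧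
        Summable (fun a : Fin (n i) →₀ ℕ => |c i a| * R i ^ a.degree) ∧
        (∀ x ∈ Set.pi Set.univ (fun _ : Fin (n i) => Set.Icc (0:ℝ) 1),
          HasSum (fun a : Fin (n i) →₀ ℕ => c i a * ∏ j, x j ^ a j) (h i x)) ∧
        (t i).domain = Set.pi Set.univ (fun _ : Fin (n i) => Set.Icc (0:ℝ) 1) ∧
        (∀ x ∈ Set.pi Set.univ (fun _ : Fin (n i) => Set.Icc (0:ℝ) 1), (t i).integrand x = h i x)) →
      ∃ (N : ℕ) (h' : (Fin N → ℝ) → ℝ) (V' : Set (Fin N → ℝ)) (c' : (Fin N →₀ ℕ) → ℝ) (R' : ℝ)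
        (t' : IntegralRep N),
        IsOpen V' ∧ Set.pi Set.univ (fun _ : Fin N => Set.Icc (0:ℝ) 1) ⊆ V' ∧
        IsSemialgebraicFunOn ℚ V' h' ∧ 1 < R' ∧
        Summable (fun a : Fin N →₀ ℕ => |c' a| * R' ^ a.degree) ∧
        (∀ x ∈ Set.pi Set.univ (fun _ : Fin N => Set.Icc (0:ℝ) 1),
          HasSum (fun a : Fin N →₀ ℕ => c' a * ∏ j, x j ^ a j) (h' x)) ∧
        t'.domain = Set.pi Set.univ (fun _ : Fin N => Set.Icc (0:ℝ) 1) ∧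
        (∀ x ∈ Set.pi Set.univ (fun _ : Fin N => Set.Icc (0:ℝ) 1), t'.integrand x = h' x) ∧
        ∑ i, ε i • of (t i) - of t' ∈ relations := by
  classical
  intro S n ε h V c R t hyp
  have hVo := fun i => (hyp i).1
  have hVsub := fun i => (hyp i).2.1
  have hsa := fun i => (hyp i).2.2.1
  have hR1 := fun i => (hyp i).2.2.2.1
  have hsum := fun i => (hyp i).2.2.2.2.1
  have hHas := fun i => (hyp i).2.2.2.2.2.1
  have htd := fun i => (hyp i).2.2.2.2.2.2.1
  have hti := fun i => (hyp i).2.2.2.2.2.2.2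
  -- a common dimension and the coordinate projections `prᵢ x = (x ∘ Fin.castLE)`
  obtain ⟨N, hle⟩ : ∃ N : ℕ, ∀ i, n i ≤ N :=
    ⟨Finset.univ.sup n, fun i => Finset.le_sup (f := n) (Finset.mem_univ i)⟩
  have pr_mem : ∀ i, ∀ x ∈ Set.pi Set.univ (fun _ : Fin N => Set.Icc (0:ℝ) 1),
      (fun l => x (Fin.castLE (hle i) l)) ∈
        Set.pi Set.univ (fun _ : Fin (n i) => Set.Icc (0:ℝ) 1) :=
    fun i x hx l _ => hx (Fin.castLE (hle i) l) (mem_univ _)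
  have hcube : Literature.ModelTheory.ExponentialFields.IsSemialgebraic ℚ
      (Set.pi Set.univ (fun _ : Fin N => Set.Icc (0:ℝ) 1)) := by
    rw [← cube_eq_pi]
    exact isSemialgebraic_cube
  -- (1) lift every member to dimension `N`; (2) absorb the signs; (3) add
  choose tl htl_d htl_i htl_r using fun i => liftCube' (n i) N (hle i) (t i) (htd i)
  choose ts hts_d hts_i hts_r using fun i => exists_zsmulRep (tl i) (ε i)
  obtain ⟨t', ht'd, ht'i, ht'r⟩ := exists_sumRep _ hcube ts fun i => (hts_d i).trans (htl_d i)
  -- a common radius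
  obtain ⟨R', hR'1, hR'le⟩ : ∃ R' : ℝ, 1 < R' ∧ ∀ i, R' ≤ R i := by
    rcases isEmpty_or_nonempty (Fin S) with hS | hS
    · exact ⟨2, by norm_num, fun i => (hS.false i).elim⟩
    · obtain ⟨i₀, hi₀⟩ := Finite.exists_min R
      exact ⟨R i₀, hR1 i₀, hi₀⟩
  have hR'0 : 0 ≤ R' := zero_le_one.trans hR'1.le
  -- the germ data of the merged representation
  let V' : Set (Fin N → ℝ) :=
    ⋂ i ∈ (Finset.univ : Finset (Fin S)), {x | (fun l => x (Fin.castLE (hle i) l)) ∈ V i}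
  let h' : (Fin N → ℝ) → ℝ := fun x => ∑ i, (ε i : ℝ) * h i (fun l => x (Fin.castLE (hle i) l))
  let ce : (i : Fin S) → (Fin N →₀ ℕ) → ℝ := fun i =>
    Function.extend (Finsupp.embDomain (M := ℕ) (Fin.castLEEmb (hle i))) (c i) 0
  let c' : (Fin N →₀ ℕ) → ℝ := fun b => ∑ i, (ε i : ℝ) * ce i b
  have hV'sa : Literature.ModelTheory.ExponentialFields.IsSemialgebraic ℚ V' :=
    Literature.ModelTheory.ExponentialFields.IsSemialgebraic.biInter Finset.univ
      (fun i => {x : Fin N → ℝ | (fun l => x (Fin.castLE (hle i) l)) ∈ V i}) fun i _ =>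
      (IsSemialgebraicFunOn.isSemialgebraic_holds (hsa i)).preimage_comp (Fin.castLE (hle i))
  have hV'sub : ∀ i, V' ⊆ {x | (fun l => x (Fin.castLE (hle i) l)) ∈ V i} := fun i x hx =>
    Set.mem_iInter₂.mp hx i (Finset.mem_univ i)
  refine ⟨N, h', V', c', R', t', ?_, ?_, ?_, hR'1, ?_, ?_, ht'd, ?_, ?_⟩
  · -- `V'` is open
    exact isOpen_biInter_finset fun i _ =>
      (hVo i).preimage (continuous_pi fun l => continuous_apply (Fin.castLE (hle i) l))
  · -- the closed cube lies in `V'`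
    exact fun x hx => Set.mem_iInter₂.mpr fun i _ => hVsub i (pr_mem i x hx)
  · -- `h'` is `ℚ`-semialgebraic on `V'`
    refine isSemialgebraicFunOn_finset_sum Finset.univ hV'sa fun i _ => ?_
    have h1 : IsSemialgebraicFunOn ℚ V' (fun x => h i (fun l => x (Fin.castLE (hle i) l))) :=
      (isSemialgebraicFunOn_comp_coord (Fin.castLE (hle i)) (hsa i)).mono (hV'sub i) hV'sa
    exact (IsSemialgebraicFunOn.mul_holds (isSemialgebraicFunOn_ratCast hV'sa (ε i : ℚ)) h1).congr
      fun x _ => by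
        show ((ε i : ℚ) : ℝ) * h i (fun l => x (Fin.castLE (hle i) l)) =
          (ε i : ℝ) * h i (fun l => x (Fin.castLE (hle i) l))
        rw [Rat.cast_intCast]
  · -- absolute convergence at the polyradius `R'`
    show Summable fun b : Fin N →₀ ℕ => |∑ i, (ε i : ℝ) * ce i b| * R' ^ b.degree
    have hmaj : ∀ i, Summable fun b : Fin N →₀ ℕ => |(ε i : ℝ)| * (|ce i b| * R i ^ b.degree) :=
      fun i => (summable_extend_embDomain (hle i) (c i) (R i) (hsum i)).mul_left _
    refine Summable.of_nonneg_of_le (fun b => mul_nonneg (abs_nonneg _) (pow_nonneg hR'0 _))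
      (fun b => ?_) (summable_sum (s := Finset.univ) fun i _ => hmaj i)
    calc |∑ i, (ε i : ℝ) * ce i b| * R' ^ b.degree
        ≤ (∑ i, |(ε i : ℝ)| * |ce i b|) * R' ^ b.degree := by
          refine mul_le_mul_of_nonneg_right ?_ (pow_nonneg hR'0 _)
          exact (Finset.abs_sum_le_sum_abs _ _).trans_eq
            (Finset.sum_congr rfl fun i _ => abs_mul _ _)
      _ = ∑ i, |(ε i : ℝ)| * (|ce i b| * R' ^ b.degree) := by
          rw [Finset.sum_mul]
          exact Finset.sum_congr rfl fun i _ => mul_assoc _ _ _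
      _ ≤ ∑ i, |(ε i : ℝ)| * (|ce i b| * R i ^ b.degree) :=
          Finset.sum_le_sum fun i _ => mul_le_mul_of_nonneg_left
            (mul_le_mul_of_nonneg_left (pow_le_pow_left₀ hR'0 (hR'le i) _) (abs_nonneg _))
            (abs_nonneg _)
  · -- the power series sums to `h'` on the closed cube
    intro x hx
    show HasSum (fun b : Fin N →₀ ℕ => (∑ i, (ε i : ℝ) * ce i b) * ∏ j, x j ^ b j)
      (∑ i, (ε i : ℝ) * h i (fun l => x (Fin.castLE (hle i) l)))
    have e : (fun b : Fin N →₀ ℕ => (∑ i, (ε i : ℝ) * ce i b) * ∏ j, x j ^ b j) =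
        fun b => ∑ i, (ε i : ℝ) * (ce i b * ∏ j, x j ^ b j) := by
      funext b
      rw [Finset.sum_mul]
      exact Finset.sum_congr rfl fun i _ => mul_assoc _ _ _
    rw [e]
    exact hasSum_sum fun i _ =>
      (hasSum_extend_embDomain (hle i) (c i) x (hHas i _ (pr_mem i x hx))).mul_left _
  · -- the integrand of `t'` is `h'` on the closed cube
    intro x hx
    rw [ht'i]
    show ∑ i, (ts i).integrand x = ∑ i, (ε i : ℝ) * h i (fun l => x (Fin.castLE (hle i) l))
    refine Finset.sum_congr rfl fun i _ => ?_
    rw [hts_i i]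
    show (ε i : ℝ) * (tl i).integrand x = _
    rw [htl_i i x hx, hti i _ (pr_mem i x hx)]
  · -- the relation
    have e : ∑ i, ε i • of (t i) - of t' = ∑ i, ε i • (of (t i) - of (tl i)) +
        ∑ i, (ε i • of (tl i) - of (ts i)) + (∑ i, of (ts i) - of t') := by
      simp only [smul_sub, Finset.sum_sub_distrib]
      abel
    rw [e]
    exact relations.add_mem (relations.add_mem
      (AddSubgroup.sum_mem _ fun i _ => AddSubgroup.zsmul_mem _ (htl_r i) _)
      (AddSubgroup.sum_mem _ fun i _ => hts_r i)) ht'r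

end Summit.KontsevichZagierPeriods.KontsevichZagierPeriods.StokesGenerationLine
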